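import Mathlib.RepresentationTheory.Basic
import Mathlib.LinearAlgebra.Prod
import Mathlib.Algebra.Module.Submodule.Equiv
import Mathlib.Algebra.Module.Projective
import Literature.RepresentationTheory.OneCocycleExtension
import Literature.RepresentationTheory.FirstOrderDeformationInvariantSubspace
import HarnessLib

/-!
# Invariant transversals of a cocycle extension: «an invariant complement splits the extension» («INVARIANT TRANSVERSAL»)

Generic representation theory over a commutative ring `k` (any monoid `G`), Mathlib-only, THEOREMS ONLY (no `def`, no instance, no named
fact); letters of the tree's `OneCocycleExtension`: representations `ρ` on `U`, `ρ'` on `U'`, a Hom-valued 1-cocycle `c : G → (U' →ₗ U)`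
and its extension `E` on `U × U'`, `E g (u, u') = (ρ g u + c g u', ρ' g u')` (sub `U × 0 = ker snd`, quotient `snd`).

* §1 **INVARIANT TRANSVERSAL ⟹ EQUIVARIANT SECTION.**  An `E`-invariant submodule `S ≤ U × U'` which is a TRANSVERSAL to the sub —
  `Disjoint S (ker snd)` and `S.map snd = ⊤` — is the image of an equivariant `k`-linear section of `snd`
  (`exists_equivariant_section_of_invariant_transversal`; any commutative ring: `snd|_S` is bijective, invert it); hence, by
  `OneCocycleExtension` §2, `c` is a coboundary (`coboundary_of_invariant_transversal`).
* §2 CONVERSE AND «IFF»: the range of an equivariant section is an invariant transversal (`range_section_invariant_transversal`), so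
  «∃ invariant transversal ⟺ ∃ equivariant section ⟺ coboundary» (`exists_invariant_transversal_iff_coboundary`).
* §3 EMBEDDING FORM: an equivariant `ψ : X → U × U'` from any representation `τ` on `X` whose range is a transversal forces a coboundary
  (`coboundary_of_equivariant_map_transversal`) — the shape in which a consumer meets it («a module mapping into the extension with image
  a graph»).
* §4 JET-WINDOW COROLLARY (with the tree's `FirstOrderDeformationInvariantSubspace`): in the window model `E_{c̄}` on `(V ⧸ A) × A` of a
  first-order deformation pair `(π₀, π₁)` and a `π₀`-invariant `A`, an invariant transversal exists iff `A` deforms to first order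
  (`exists_invariant_transversal_jetWindow_iff_deforms`, `A` projective over `k`), and under first-order NON-degeneracy no representation
  maps equivariantly into `E_{c̄}` with transversal range (`not_transversal_range_of_not_deforms`).

SOURCES (what is formalised, read at our letters).  [Brown1982, Ch. IV §2 Prop. 2.1 p. 87 and pp. 88–89]: for a split extension the
splittings correspond to complements (here: invariant submodules meeting the kernel trivially and mapping onto the quotient) and to
derivations ∕ principal derivations — our §1–§2 are this correspondence for `k[G]`-module extensions with a `k`-linear splitting, in the
block-matrix currency of `OneCocycleExtension`; §4 is its instance for the flag-deformation cocycle of [HuybrechtsLehn1997, App. 2.A.7].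
Deliberately NOT here: `H¹` as an object, uniqueness of the complement up to `H⁰`, topology.
-/

set_option autoImplicit false

namespace Literature.RepresentationTheory

variable {k : Type*} [CommRing k] {G : Type*} [Monoid G]
variable {U U' : Type*} [AddCommGroup U] [Module k U] [AddCommGroup U'] [Module k U']

/-! ## §1 Invariant transversal ⟹ equivariant section ⟹ coboundary -/

/-- **INVARIANT TRANSVERSAL ⟹ EQUIVARIANT SECTION.**  In the cocycle extension `E` on `U × U'`, an `E`-invariant submodule `S` with
`Disjoint S (ker snd)` and `S.map snd = ⊤` is the range of an equivariant `k`-linear section of `snd`: there is `s : U' →ₗ U × U'` with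
`(s u').2 = u'`, `s u' ∈ S` and `E g (s u') = s (ρ' g u')`.  Any commutative ring `k`.
[cite: Brown1982, Ch. IV §2 Prop. 2.1 p. 87] [cite: Brown1982, Ch. IV §2 pp. 88–89] -/
theorem exists_equivariant_section_of_invariant_transversal (ρ : Representation k G U) (ρ' : Representation k G U')
    (c : G → U' →ₗ[k] U) (E : Representation k G (U × U')) (hE : ∀ g u u', E g (u, u') = (ρ g u + c g u', ρ' g u'))
    (S : Submodule k (U × U')) (hS : ∀ g, S ≤ S.comap (E g))
    (hdisj : Disjoint S (LinearMap.ker (LinearMap.snd k U U'))) (honto : S.map (LinearMap.snd k U U') = ⊤) :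
    ∃ s : U' →ₗ[k] (U × U'), (∀ u', (s u').2 = u') ∧ (∀ u', s u' ∈ S) ∧ ∀ g u', E g (s u') = s (ρ' g u') := by
  set f : S →ₗ[k] U' := (LinearMap.snd k U U').domRestrict S with hf
  have hinj : Function.Injective f := LinearMap.injective_domRestrict_iff.mpr hdisj
  have hsurj : Function.Surjective f := by
    rw [← LinearMap.range_eq_top, hf, LinearMap.range_domRestrict, honto]
  let e : S ≃ₗ[k] U' := LinearEquiv.ofBijective f ⟨hinj, hsurj⟩
  have he : ∀ x : S, e x = (x : U × U').2 := fun x => rfl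
  have hsec : ∀ u', ((e.symm u' : S) : U × U').2 = u' := fun u' => by
    rw [← he, LinearEquiv.apply_symm_apply]
  refine ⟨S.subtype ∘ₗ (e.symm : U' →ₗ[k] S), hsec, fun u' => (e.symm u').2, fun g u' => ?_⟩
  -- both `E g (s u')` and `s (ρ' g u')` lie in `S` and have the same second component; `snd` is injective on `S`.
  have hmem₁ : E g ((e.symm u' : S) : U × U') ∈ S := hS g (e.symm u').2
  have hmem₂ : ((e.symm (ρ' g u') : S) : U × U') ∈ S := (e.symm (ρ' g u')).2
  have hsnd : (E g ((e.symm u' : S) : U × U')).2 = ((e.symm (ρ' g u') : S) : U × U').2 := by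
    rw [snd_cocycleRep_apply ρ ρ' c E hE, hsec, hsec]
  have hinjOn : Set.InjOn (LinearMap.snd k U U') (S : Set (U × U')) :=
    LinearMap.injOn_of_disjoint_ker (le_refl _) hdisj
  exact hinjOn hmem₁ hmem₂ hsnd

/-- **INVARIANT TRANSVERSAL ⟹ COBOUNDARY.**  Under the hypotheses of `exists_equivariant_section_of_invariant_transversal` the cocycle
is a coboundary: `c g = t ∘ ρ' g - ρ g ∘ t` for some `t : U' →ₗ U` (by `OneCocycleExtension` §2).
[cite: Brown1982, Ch. IV §2 Prop. 2.3 p. 89] -/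
theorem coboundary_of_invariant_transversal (ρ : Representation k G U) (ρ' : Representation k G U')
    (c : G → U' →ₗ[k] U) (E : Representation k G (U × U')) (hE : ∀ g u u', E g (u, u') = (ρ g u + c g u', ρ' g u'))
    (S : Submodule k (U × U')) (hS : ∀ g, S ≤ S.comap (E g))
    (hdisj : Disjoint S (LinearMap.ker (LinearMap.snd k U U'))) (honto : S.map (LinearMap.snd k U U') = ⊤) :
    ∃ t : U' →ₗ[k] U, ∀ g, c g = t ∘ₗ ρ' g - ρ g ∘ₗ t := by
  obtain ⟨s, hs, -, hequiv⟩ := exists_equivariant_section_of_invariant_transversal ρ ρ' c E hE S hS hdisj honto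
  exact (exists_equivariant_section_iff_coboundary ρ ρ' c E hE).mp ⟨s, hs, hequiv⟩

/-! ## §2 Converse: the range of an equivariant section is an invariant transversal -/

/-- **CONVERSE.**  The range of an equivariant `k`-linear section `s` of `snd` is `E`-invariant, meets `ker snd` trivially and maps onto `U'`.
[cite: Brown1982, Ch. IV §2 Prop. 2.1 p. 87] -/
theorem range_section_invariant_transversal (ρ' : Representation k G U') (E : Representation k G (U × U'))
    (s : U' →ₗ[k] (U × U')) (hs : ∀ u', (s u').2 = u') (hequiv : ∀ g u', E g (s u') = s (ρ' g u')) :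
    (∀ g, LinearMap.range s ≤ (LinearMap.range s).comap (E g)) ∧
      Disjoint (LinearMap.range s) (LinearMap.ker (LinearMap.snd k U U')) ∧
        (LinearMap.range s).map (LinearMap.snd k U U') = ⊤ := by
  refine ⟨fun g => ?_, ?_, ?_⟩
  · rintro x ⟨u', rfl⟩
    rw [Submodule.mem_comap, hequiv]
    exact LinearMap.mem_range_self s _
  · rw [Submodule.disjoint_def]
    rintro x ⟨u', rfl⟩ hx
    rw [LinearMap.mem_ker, LinearMap.snd_apply, hs] at hx
    rw [hx, map_zero]
  · rw [eq_top_iff]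
    rintro u' -
    exact ⟨s u', LinearMap.mem_range_self s u', hs u'⟩

/-- **«∃ INVARIANT TRANSVERSAL ⟺ COBOUNDARY».**  For the cocycle extension `E` of `c`:
`(∃ S ≤ U × U', S invariant ∧ Disjoint S (ker snd) ∧ S.map snd = ⊤) ↔ ∃ t, ∀ g, c g = t ∘ ρ' g - ρ g ∘ t`.
[cite: Brown1982, Ch. IV §2 Prop. 2.3 p. 89] [cite: Brown1982, Ch. IV §2 Prop. 2.1 p. 87] -/
theorem exists_invariant_transversal_iff_coboundary (ρ : Representation k G U) (ρ' : Representation k G U')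
    (c : G → U' →ₗ[k] U) (E : Representation k G (U × U')) (hE : ∀ g u u', E g (u, u') = (ρ g u + c g u', ρ' g u')) :
    (∃ S : Submodule k (U × U'), (∀ g, S ≤ S.comap (E g)) ∧ Disjoint S (LinearMap.ker (LinearMap.snd k U U')) ∧
        S.map (LinearMap.snd k U U') = ⊤) ↔
      ∃ t : U' →ₗ[k] U, ∀ g, c g = t ∘ₗ ρ' g - ρ g ∘ₗ t := by
  constructor
  · rintro ⟨S, hS, hdisj, honto⟩
    exact coboundary_of_invariant_transversal ρ ρ' c E hE S hS hdisj honto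
  · intro ht
    obtain ⟨s, hs, hequiv⟩ := (exists_equivariant_section_iff_coboundary ρ ρ' c E hE).mpr ht
    exact ⟨LinearMap.range s, range_section_invariant_transversal ρ' E s hs hequiv⟩

/-! ## §3 Embedding form -/

section Embedding

variable {X : Type*} [AddCommGroup X] [Module k X]

/-- **A MODULE MAPPING EQUIVARIANTLY ONTO A TRANSVERSAL FORCES A COBOUNDARY.**  If `τ` is a representation on `X` and `ψ : X →ₗ U × U'`
intertwines `τ` with `E` (`ψ (τ g x) = E g (ψ x)`), with `Disjoint (range ψ) (ker snd)` and `snd ∘ ψ` onto, then `c` is a coboundary.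
[cite: Brown1982, Ch. IV §2 Prop. 2.3 p. 89] -/
theorem coboundary_of_equivariant_map_transversal (ρ : Representation k G U) (ρ' : Representation k G U')
    (c : G → U' →ₗ[k] U) (E : Representation k G (U × U')) (hE : ∀ g u u', E g (u, u') = (ρ g u + c g u', ρ' g u'))
    (τ : Representation k G X) (ψ : X →ₗ[k] (U × U')) (hψ : ∀ g x, ψ (τ g x) = E g (ψ x))
    (hdisj : Disjoint (LinearMap.range ψ) (LinearMap.ker (LinearMap.snd k U U')))
    (honto : Function.Surjective (LinearMap.snd k U U' ∘ₗ ψ)) :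
    ∃ t : U' →ₗ[k] U, ∀ g, c g = t ∘ₗ ρ' g - ρ g ∘ₗ t := by
  refine coboundary_of_invariant_transversal ρ ρ' c E hE (LinearMap.range ψ) (fun g => ?_) hdisj ?_
  · rintro y ⟨x, rfl⟩
    rw [Submodule.mem_comap, ← hψ]
    exact LinearMap.mem_range_self ψ _
  · rw [← LinearMap.range_comp]
    exact LinearMap.range_eq_top.mpr honto

end Embedding

/-! ## §4 The JET-WINDOW corollary -/

section JetWindow

variable {V : Type*} [AddCommGroup V] [Module k V]

/-- **INVARIANT TRANSVERSAL IN THE WINDOW ⟺ `A` DEFORMS TO FIRST ORDER** (for `A` projective over `k`, e.g. `k` a field).  In the model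
`E_{c̄}` on `(V ⧸ A) × A` of the window of the jet module of `(π₀, π₁)` over a `π₀`-invariant `A` (block cocycle
`c̄ g = mkQ_A ∘ π₁ g ∘ ι_A`), an `E_{c̄}`-invariant submodule meeting `(V ⧸ A) × 0` trivially and mapping onto `A` exists iff
`∃ L : A →ₗ V, ∀ g a, π₁ g a + π₀ g (L a) - L (π₀ g a) ∈ A`.
[cite: HuybrechtsLehn1997, App. 2.A.7 (Flags of subsheaves)] [cite: Brown1982, Ch. IV §2 Prop. 2.3 p. 89] -/
theorem exists_invariant_transversal_jetWindow_iff_deforms (π₀ : Representation k G V) (π₁ : G → Module.End k V)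
    (A : Submodule k V) [Module.Projective k A] (hA : ∀ g, A ≤ A.comap (π₀ g)) (c : G → A →ₗ[k] V ⧸ A)
    (hc : ∀ g, c g = A.mkQ ∘ₗ π₁ g ∘ₗ A.subtype) (E : Representation k G ((V ⧸ A) × A))
    (hE : ∀ g u a, E g (u, a) = (π₀.quotient A hA g u + c g a, π₀.subrepresentation A hA g a)) :
    (∃ S : Submodule k ((V ⧸ A) × A), (∀ g, S ≤ S.comap (E g)) ∧
        Disjoint S (LinearMap.ker (LinearMap.snd k (V ⧸ A) A)) ∧ S.map (LinearMap.snd k (V ⧸ A) A) = ⊤) ↔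
      ∃ L : A →ₗ[k] V, ∀ g (a : A), π₁ g (a : V) + π₀ g (L a) - L (π₀.subrepresentation A hA g a) ∈ A :=
  (exists_invariant_transversal_iff_coboundary (π₀.quotient A hA) (π₀.subrepresentation A hA) c E hE).trans
    (deforms_iff_jetBlock_coboundary π₀ π₁ A hA c hc).symm

variable {X : Type*} [AddCommGroup X] [Module k X]

/-- **NON-DEGENERACY FORM.**  If `A` does NOT deform to first order along `(π₀, π₁)` (`A` projective over `k`), then no representation
`τ` on any `X` maps equivariantly into the window model `E_{c̄}` with range meeting `(V ⧸ A) × 0` trivially and projecting onto `A`.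
[cite: HuybrechtsLehn1997, App. 2.A.7 (Flags of subsheaves)] -/
theorem not_transversal_range_of_not_deforms (π₀ : Representation k G V) (π₁ : G → Module.End k V)
    (A : Submodule k V) [Module.Projective k A] (hA : ∀ g, A ≤ A.comap (π₀ g)) (c : G → A →ₗ[k] V ⧸ A)
    (hc : ∀ g, c g = A.mkQ ∘ₗ π₁ g ∘ₗ A.subtype) (E : Representation k G ((V ⧸ A) × A))
    (hE : ∀ g u a, E g (u, a) = (π₀.quotient A hA g u + c g a, π₀.subrepresentation A hA g a))
    (hnd : ¬ ∃ L : A →ₗ[k] V, ∀ g (a : A), π₁ g (a : V) + π₀ g (L a) - L (π₀.subrepresentation A hA g a) ∈ A)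
    (τ : Representation k G X) (ψ : X →ₗ[k] ((V ⧸ A) × A)) (hψ : ∀ g x, ψ (τ g x) = E g (ψ x))
    (hdisj : Disjoint (LinearMap.range ψ) (LinearMap.ker (LinearMap.snd k (V ⧸ A) A))) :
    ¬ Function.Surjective (LinearMap.snd k (V ⧸ A) A ∘ₗ ψ) := fun honto =>
  hnd ((deforms_iff_jetBlock_coboundary π₀ π₁ A hA c hc).mpr
    (coboundary_of_equivariant_map_transversal (π₀.quotient A hA) (π₀.subrepresentation A hA) c E hE τ ψ hψ hdisj honto))

end JetWindow

end Literature.RepresentationTheory
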